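import Literature.IUT.HodgeTheaters.PMBaseEx63IndependenceProofs
import Literature.IUT.HodgeTheaters.PMBaseEx63ConsistencyProofs
import Literature.IUT.HodgeTheaters.PMBaseBridgePropsProofs5
import Literature.IUT.HodgeTheaters.PMBaseNegCompatSub

/-!
# [IUTchI] Example 6.3 (ii) `Ex63.Equivariant` as a SCHEMA (FACT-LIST F-2027): kernel verdict

S. Mochizuki, *Inter-universal Teichmüller theory I: construction of Hodge theaters*, §6, Example 6.3 (ii)
p. 161 of the kurims manuscript (May 2020): "`φ^{Θell}_±` is equivariant with respect to these poly-actions of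
`𝔽_l^{⋊±}` on `𝔇_±` and `𝒟^{⊚±}`" [claim: Mochizuki2012, status: disputed].  PROOF-ONLY companion (theorems, no
definitions) of abc-iut-L5-t4's `PMBaseModels.lean` (abc-iut cell, block F fact-proving wave, seat abc-iut-f-071
gen 3; FACT-LIST row **F-2027** `PMBaseKit.Ex63.Equivariant`, class `IUTch`, kernel_closedness `parametrised`;
its label «proved(_holds)» was a short-name collision with an unrelated `equivariant_holds`, abc-iut-w5-d074).
Nothing is restated and no notion is declared: `Ex63.Equivariant K γ` is a PREDICATE on abstract data — a base
kit `K : PMBaseKit l` (abc-iut-L5-t4's interface for the outputs of [IUTchI] Def 6.1 (ii)–(vii)) and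
`γ ∈ 𝔽_l^{⋊±}`.  Plan rule R1 for parametrised rows: decide the UNIVERSAL CLOSURE; if false, file
`not_forall_<decl>` and prove / cite the instance forms.

Kernel verdict (heavy lifting CITED BY NAME: abc-iut-L5-t13 `Ex63.equivariant_of_isPositive`,
`Ex63.exists_kit_not_equivariant`, `Ex63.equivariant_of_negCompat`; abc-iut-w4-d073
`Ex63.equivariant_toyKit_of_isNegative`; abc-iut-w5-d086 `Ex63.NegCompatModel` / `NegCompatModel.equivariant`):

* `Ex63.not_forall_equivariant` — the universal closure `∀ l K γ, Ex63.Equivariant K γ` is FALSE (abc-iut-L5-t13's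
  kit with `φ^{Θell}_{•,v}` the translation `z ↦ z + 1`, at `γ = (0, −1)`, `l = 3`).
* NEW exact side condition per kit, `Ex63.negCompatModel_iff_forall_equivariant`:
  `Ex63.NegCompatModel K ↔ ∀ γ, Ex63.Equivariant K γ` — the universal-in-`γ` form of the row over a kit `K` is
  EQUIVALENT to abc-iut-w5-d086's named `[−1]`-compatibility of `φ^{Θell}_{•,v}` (→ is L5-t13's positive half plus
  `NegCompatModel.equivariant`; ← is `Ex63.negCompatModel_of_equivariant`, read off the equivariance at
  `(t, γ) = (0, (0, −1))`).
* Instance forms PROVED: `∀ K` for positive `γ` (cited); at abc-iut-L5-t4's consistency model for EVERY `γ`,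
  `Ex63.equivariant_toyKit`.

Verdict conjunction `Ex63.equivariant_schema_verdict`.  Refuting a universal closure over OUR interface `PMBaseKit`
says nothing about the printed "one verifies immediately" for the genuine objects of [IUTchI]; nothing here takes
a side on [IUTchIII] Cor. 3.12 or asserts that abc is proved or refuted; typed ≠ proved; a FACT-LIST row is an
assumption label, proved/refuted = OUR kernel check only.
-/

namespace Literature.IUT.HodgeTheaters

open CategoryTheory

universe u

namespace PMBaseKit

namespace Ex63

variable {l : ℕ} {K : PMBaseKit.{u} l}

/-- **The `[−1]`-compatibility of `φ^{Θell}_{•,v}` from Example 6.3 (ii) at `γ = (0, −1)`** ([IUTchI] Ex 6.3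
(ii) p. 161, read through Ex 6.2 (ii)/(iii) pp. 159–160 and Def 6.1 (v) p. 158): if `φ^{Θell}_±` is equivariant
for the single element `(0, −1) ∈ 𝔽_l^{⋊±}`, then at every `v ∈ 𝕍` some NEGATIVE automorphism `a` of `𝒟_v` and
some lift `b ∈ Aut_±(𝒟^{⊚±})` of `(0, −1)` satisfy `a ≫ φ^{Θell}_{•,v} = φ^{Theta ell}_{•,v} ≫ b`
(abc-iut-w5-d086's `Ex63.NegCompatModel K`).  Proof: the member `φ^{Θell}_{•,v} ≫ b₀ ≫ b` (`b₀` a lift of the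
translation `0`, `b` a lift of `(0, −1)`) of the left-hand side of the equivariance at the label `t = 0` is a
member `p_v ≫ a' ≫ φ^{Θell}_{•,v} ≫ b'` of the right-hand side (`p_v` negative, `a'` positive,
`b' ∈ Aut_csp(𝒟^{⊚±})`); take `a := p_v ≫ a'` and the lift `b₀ ≫ b ≫ b'⁻¹`.  The converse of abc-iut-L5-t13's
`Ex63.equivariant_of_negCompat`. [claim: Mochizuki2012, status: disputed] -/
theorem negCompatModel_of_equivariant (h : Equivariant K (FlPM.mk 0 (-1))) : NegCompatModel K := by
  intro v
  obtain ⟨b₀, hb₀⟩ := lifts_nonempty (K := K) (FlPM.transl 0)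
  obtain ⟨b, hb⟩ := lifts_nonempty (K := K) (FlPM.mk 0 (-1))
  -- a member of `φ^{Θell}_{v_0}` and the corresponding member of the left-hand side at `t = 0`
  have hf : K.phiEll v ≫ (K.atV v).map b₀.hom ∈ poly K 0 v :=
    ⟨1, one_mem _, b₀, hb₀, by change _ = 𝟙 _ ≫ _; exact (Category.id_comp _).symm⟩
  have hmem : (K.phiEll v ≫ (K.atV v).map b₀.hom) ≫ (K.atV v).map b.hom ∈
      {h | ∃ p ∈ (polyAction K (FlPM.mk (l := l) 0 (-1))).onCapsule (0 : ZMod l),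
        ∃ g ∈ poly K (FlPM.mk (l := l) 0 (-1) • (0 : ZMod l)) v, h = (p v).hom ≫ g} := by
    rw [← h 0 v]
    exact ⟨_, hf, b, hb, rfl⟩
  obtain ⟨p, hp, g, hg, heq⟩ := hmem
  -- `p_v` is negative, `g = a' ≫ φ^{Θell}_{•,v} ≫ b'` with `a'` positive and `b'` cuspidal
  have hpv : p v ∈ K.autMinus v (K.model v) := (hp v).2 rfl
  obtain ⟨a', ha', b', hb', rfl⟩ := hg
  have hγ0 : FlPM.mk (l := l) 0 (-1) • (0 : ZMod l) = 0 := by simp [FlPM.mk_smul]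
  rw [hγ0, lifts_transl_zero] at hb'
  have hb's : b'.symm ∈ K.autCsp K.gModel := by
    have := (K.autCsp K.gModel).inv_mem hb'
    rwa [Aut.Aut_inv_def] at this
  -- the product of the two lifts is a lift of `(0, −1) · (0, +1) = (0, −1)`
  have hprod : FlPM.mk (l := l) 0 (-1) * FlPM.transl 0 = FlPM.mk 0 (-1) := by
    ext <;> simp [FlPM.transl, FlPM.mk]
  have hb₀b : b₀ ≪≫ b ∈ lifts K (FlPM.mk 0 (-1)) := by
    have := trans_mem_lifts hb₀ hb
    rwa [hprod] at this
  refine ⟨p v ≪≫ a', ?_, (b₀ ≪≫ b) ≪≫ b'.symm, trans_csp_mem_lifts hb₀b hb's, ?_⟩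
  · -- `LabCusp^±(p_v ≫ a') = LabCusp^±(p_v) = −1`
    rw [K.labMap_trans, (K.mem_autPlus_iff a').mp ha', Equiv.trans_refl]
    exact (labMap_ne_refl_iff (K.isLocal_model v) (p v)).mp fun hc => hpv ((K.mem_autPlus_iff _).mpr hc)
  · -- the commutation, from `heq` post-composed with `b'⁻¹`
    have heq' := heq =≫ (K.atV v).map b'.inv
    simp only [Category.assoc, ← CategoryTheory.Functor.map_comp, Iso.hom_inv_id,
      CategoryTheory.Functor.map_id, Category.comp_id] at heq'
    simp only [Iso.trans_hom, Iso.symm_hom, Category.assoc]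
    exact heq'.symm

/-- **Exact side condition for F-2027 over a kit** ([IUTchI] Ex 6.3 (ii) p. 161): the universal-in-`γ` form of
the row, `∀ γ ∈ 𝔽_l^{⋊±}, Ex63.Equivariant K γ`, holds over a base kit `K` IF AND ONLY IF `K` has the
`[−1]`-compatibility of `φ^{Θell}_{•,v}` (`Ex63.NegCompatModel K`, abc-iut-w5-d086; the binder `hβ` of the
branch-C certificate `layer5_held_sec6`).  `→`: positive `γ` unconditionally (abc-iut-L5-t13
`equivariant_of_isPositive`), negative `γ` by `NegCompatModel.equivariant`; `←`: `negCompatModel_of_equivariant`.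
[claim: Mochizuki2012, status: disputed] -/
theorem negCompatModel_iff_forall_equivariant : NegCompatModel K ↔ ∀ γ : FlPM l, Equivariant K γ := by
  constructor
  · intro h γ
    rcases FlPM.isPositive_or_isNegative γ with hγ | hγ
    · exact equivariant_of_isPositive hγ
    · exact h.equivariant hγ
  · intro h
    exact negCompatModel_of_equivariant (h _)

/-- **F-2027, universal closure REFUTED.**  Example 6.3 (ii) as typed (`Ex63.Equivariant K γ`) is a PREDICATE on
abstract data `(K, γ)`; its universal closure over the interface `PMBaseKit` is FALSE — witness abc-iut-L5-t13's
kit with `φ^{Θell}_{•,v}` the translation `z ↦ z + 1` of `AGL₁(𝔽_3)`, `γ = (0, −1)`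
(`Ex63.exists_kit_not_equivariant`). [claim: Mochizuki2012, status: disputed] -/
theorem not_forall_equivariant :
    ¬ ∀ (l : ℕ) (K : PMBaseKit.{0} l) (γ : FlPM l), Equivariant K γ := by
  intro h
  haveI : Fact (Nat.Prime 3) := ⟨Nat.prime_three⟩
  obtain ⟨K, -, hK⟩ := exists_kit_not_equivariant 3 (by decide)
  exact hK (h 3 K _)

/-- **F-2027, instance form at the consistency MODEL — PROVED for every `γ`**: over abc-iut-L5-t4's `toyKit l hl`
(every interface clause genuine) `φ^{Θell}_±` is equivariant for ALL `γ ∈ 𝔽_l^{⋊±}` (positive: abc-iut-L5-t13;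
negative: abc-iut-w4-d073 `equivariant_toyKit_of_isNegative`). [claim: Mochizuki2012, status: disputed] -/
theorem equivariant_toyKit (l : ℕ) [Fact l.Prime] (hl : l ≠ 2) (γ : FlPM l) :
    Equivariant (toyKit l hl) γ :=
  (negCompatModel_iff_forall_equivariant.mp (negCompatModel_toyKit l hl)) γ

/-- **F-2027, kernel verdict** ([IUTchI] Ex 6.3 (ii) p. 161): the universal closure of `Ex63.Equivariant` over
the interface is REFUTED; the item holds for every kit and every POSITIVE `γ` (zero extra binders), for every
kit with the `[−1]`-compatibility of `φ^{Θell}_{•,v}` and every `γ` — indeed `∀ γ` over `K` is EQUIVALENT to that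
compatibility — and at the consistency model `toyKit` for every `γ`.  Hence the row is a SCHEMA: bind per kit
as `Ex63.NegCompatModel K` (as `layer5_held_sec6` does), never as the closed universal closure (kernel-false).
[claim: Mochizuki2012, status: disputed] -/
theorem equivariant_schema_verdict :
    (¬ ∀ (l : ℕ) (K : PMBaseKit.{0} l) (γ : FlPM l), Equivariant K γ) ∧
    (∀ (l : ℕ) (K : PMBaseKit.{u} l) (γ : FlPM l), γ.IsPositive → Equivariant K γ) ∧
    (∀ (l : ℕ) (K : PMBaseKit.{u} l), NegCompatModel K ↔ ∀ γ : FlPM l, Equivariant K γ) ∧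
    (∀ (l : ℕ) [Fact l.Prime] (hl : l ≠ 2) (γ : FlPM l), Equivariant (toyKit l hl) γ) :=
  ⟨not_forall_equivariant, fun _ _ _ hγ => equivariant_of_isPositive hγ,
    fun _ _ => negCompatModel_iff_forall_equivariant, fun l _ hl γ => equivariant_toyKit l hl γ⟩

end Ex63

end PMBaseKit

end Literature.IUT.HodgeTheaters
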